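import Literature.Combinatorics.Sahi2008.SetPartitionForm
import Literature.Combinatorics.Sahi2008.Multilinear

/-!
# `NoHeavyLowerTail` (crux stmt-CriticalPhenomena-4575), Sahi programme: **SAHI'S `E_n` UNDER SCALING OF THE WEIGHT —
# an exact set-partition expansion at EVERY ORDER**, `E_n^{s·μ}(f) = Σ_π φ_{|π|}(s) · Π_{B∈π} E_{|B|}^{μ}(f|_B)`

Support file (Sahi cell, seat `prim-sahi-p1`, generation 51; `--supports stmt-CriticalPhenomena-4575`).  Pure proofs plus bookkeeping
definitions (`scalingCoeff`, `blockE`, `scalingSum`, `scalingTerm`); no `sorry`, standard axioms.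

THE IDENTITY (new, all orders).  For ANY finite type `α`, ANY real weight `μ : α → ℝ`, any real `s`, any `n ≥ 1` and any family
`f : Fin n → α → ℝ`:  `E_n^{s·μ}(f_0,…,f_{n−1}) = Σ_{π set partition of [n]} φ_{|π|}(s) · Π_{B ∈ π} E_{|B|}^{μ}(f|_B)`,
`φ_k(s) := s(1−s)(2−s)⋯(k−1−s)` (`φ_1 = s`, `φ_2 = s(1−s)`; `φ_0 := −1`, so `φ_{k+1} = (k − s)φ_k`).  Here `s·μ` is the weight
`x ↦ s·μ(x)` and `E_m^{μ}(f|_B)` is Sahi's functional of the sub-family indexed by the block `B` (increasing order).  READING: the joint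
moments of the TOP-ONLY family `ε·f_l` on the coin space `Bool × α` under `B_s ⊗ μ` are those of `f` under `s·μ`, so the left side is
`E_n^{B_s⊗μ}(ε·f_0,…,ε·f_{n−1})` = "`E_n` of `A_l ∩ P` for an independent event `P` of probability `s`" (companion file
`…SahiTangentScalingVertex`).  MECHANISM: in Sahi's generating function [Sahi2008, eq. (3)/(14), Prop. 12] the weight enters as
EXPONENTS, `1 − G_μ = Π_S (1 − F(S))^{μ(S)}`, so `1 − G_{s·μ} = (1 − G_μ)^s = 1 − Σ_{k≥1} (φ_k(s)/k!)·G_μ^k`; the sign computation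
`(−1)^{k−1}(s choose k) = s(1−s)⋯(k−1−s)/k! ≥ 0` is the one in Sahi's proof of his Theorem 1 (p. 218–219); polarising gives the display
(equivalently, per set partition with `m` blocks, the Stirling expansion of `s^m` in falling factorials).  The `E_n`-level identity and its
consequences below are not stated in [Sahi2008] / [LiebSahi2021] / [Richards2004]: cite as [this work].

PROOF here: recursion only.  Both sides satisfy the Lieb–Sahi recursion `X(f_0; g) = Σ_i X(g with g_i ↦ g_i f_0) − s·E_μ(f_0)·X(g)`
with the same value at `n = 1`.  For the right side this is the bookkeeping of `Sahi2008/SetPartitionForm.lean` (Mathlib's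
`OrderedFinpartition.extendEquiv`: the point `0` is a singleton block — factor `E(f_0)`, one more block — or is inserted into block `B`
of a set partition of the tail), except that THE BLOCK FUNCTIONAL `E_{|B|+1}(f_0; f|_B)` IS EXPANDED BY THE LIEB–SAHI RECURSION ITSELF:
the slots `i ∈ B` absorb `f_0` (summed over blocks this is `Σ_i Π_B E(f^{(i)}|_B)`, as modifying slot `i` only changes the block
containing `i`), and the `k` subtracted terms `−E(f_0)·Π_B E(f|_B)` (one per block) combine with the singleton-block term through
`φ_{k+1}(s) − k·φ_k(s) = −s·φ_k(s)`.

CONSEQUENCES (§4): `E_n^{s·μ}(f) − s·E_n^{μ}(f) = Σ_{|π| ≥ 2} φ_{|π|}(s) Π_{B∈π} E_{|B|}(f|_B)`; hence **for `0 ≤ s ≤ 1`, if every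
proper sub-family of `f` has `E_m ≥ 0` then `s·E_n^{μ}(f) ≤ E_n^{s·μ}(f)`** (`mul_sahiE_le_sahiE_smul`) — CONJECTURE V_∅ of memo
FROM-prim-sahi-p1-gen50 §5 (`E_n(sX) ≥ s·E_n(X)`; tangent `A_n(X) = Σ_{|π|≥2} (|π|−2)!·Π_B E_B ≥ 0`) AT EVERY ORDER, conditionally on
Sahi positivity of the proper sub-families (`E^{s·μ} ≥ 0`, the monotonicity of `s ↦ E_n^{s·μ}(f)/s`, the coin form and the FKG
instances are in the companion file `…SahiTangentScalingVertex`).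
Gen 50 proved orders `n ≤ 5` UNCONDITIONALLY for arbitrary up-sets under FKG weights by exact Harris certificates; this identity explains
why no Harris-only certificate of that shape appeared at `n = 6` (kit j313909/j314129/j314344/j314366 infeasible): the natural certificate
`Σ φ Π E_B` uses `E_3, E_4, E_5 ≥ 0` of the sub-families.  Nothing conjectural is asserted. [this work; mechanism: Sahi2008, Thm. 1 proof]
-/

namespace Summit.CriticalPhenomena.PercolationContinuityZ3.Theorems.SahiTangent

open Finset Function Literature.Combinatorics.Sahi2008
open scoped BigOperators

noncomputable section

variable {α : Type*} [Fintype α]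

/-! ### §1 The coefficients `φ_k(s) = s(1−s)(2−s)⋯(k−1−s)` -/

/-- `φ_k(s)`, defined by `φ_0 := −1`, `φ_{k+1} := (k − s)·φ_k`; so `φ_1 = s`, `φ_2 = s(1−s)`, `φ_k = s(1−s)(2−s)⋯(k−1−s)`
(`= k!·(−1)^{k−1}·(s choose k)`, the sign-corrected binomial coefficient of Sahi's proof of Theorem 1; also `= E_k^{Bern(s)}(ε,…,ε)`).
[this work; cf. Sahi2008, proof of Thm. 1 (p. 218)] -/
def scalingCoeff (s : ℝ) : ℕ → ℝ
  | 0 => -1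
  | k + 1 => ((k : ℝ) - s) * scalingCoeff s k

/-- `φ_0 = −1`. [this work] -/
theorem scalingCoeff_zero (s : ℝ) : scalingCoeff s 0 = -1 := rfl

/-- `φ_{k+1} = (k − s)·φ_k`. [this work] -/
theorem scalingCoeff_succ (s : ℝ) (k : ℕ) : scalingCoeff s (k + 1) = ((k : ℝ) - s) * scalingCoeff s k := rfl

/-- `φ_1 = s`. [this work] -/
theorem scalingCoeff_one (s : ℝ) : scalingCoeff s 1 = s := by
  rw [scalingCoeff_succ, scalingCoeff_zero, Nat.cast_zero]; ring

/-- `φ_2 = s(1 − s)`. [this work] -/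
theorem scalingCoeff_two (s : ℝ) : scalingCoeff s 2 = s * (1 - s) := by
  rw [scalingCoeff_succ, scalingCoeff_one, Nat.cast_one]; ring

/-- `φ_3 = s(1 − s)(2 − s)`. [this work] -/
theorem scalingCoeff_three (s : ℝ) : scalingCoeff s 3 = s * (1 - s) * (2 - s) := by
  rw [scalingCoeff_succ, scalingCoeff_two, Nat.cast_two]; ring

/-- `φ_k(s) ≥ 0` for `k ≥ 1` and `0 ≤ s ≤ 1`. [this work; cf. Sahi2008, proof of Thm. 1 (p. 218)] -/
theorem scalingCoeff_succ_nonneg {s : ℝ} (hs0 : 0 ≤ s) (hs1 : s ≤ 1) : ∀ k : ℕ, 0 ≤ scalingCoeff s (k + 1)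
  | 0 => by rw [scalingCoeff_one]; exact hs0
  | k + 1 => by
    rw [scalingCoeff_succ]
    refine mul_nonneg ?_ (scalingCoeff_succ_nonneg hs0 hs1 k)
    have hk : (1 : ℝ) ≤ ((k + 1 : ℕ) : ℝ) := by exact_mod_cast Nat.succ_le_succ (Nat.zero_le k)
    linarith

/-- `φ_1(1) = 1`. [this work] -/
theorem scalingCoeff_one_one : scalingCoeff 1 1 = 1 := scalingCoeff_one 1

/-- `φ_k(1) = 0` for `k ≥ 2`. [this work] -/
theorem scalingCoeff_one_add_two : ∀ k : ℕ, scalingCoeff 1 (k + 2) = 0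
  | 0 => by rw [scalingCoeff_two]; ring
  | k + 1 => by rw [scalingCoeff_succ, scalingCoeff_one_add_two k, mul_zero]

/-! ### §2 Block functionals of a set partition and the scaling sum -/

variable {n : ℕ}

/-- The block functional `E_{|B|}^{μ}(f|_B)` of block `m` of the set partition `c` of `{0,…,n−1}` (Mathlib's
`OrderedFinpartition`; the block is enumerated increasingly by `c.emb m`). [this work] -/
def blockE (μ : α → ℝ) (f : Fin n → α → ℝ) (c : OrderedFinpartition n) (m : Fin c.length) : ℝ :=
  sahiE μ (c.partSize m) (fun r => f (c.emb m r))

/-- The scaling sum `Σ_π φ_{|π|}(s) Π_{B∈π} E_{|B|}^{μ}(f|_B)` over the set partitions `π` of `{0,…,n−1}`. [this work] -/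
def scalingSum (μ : α → ℝ) (s : ℝ) (n : ℕ) (f : Fin n → α → ℝ) : ℝ :=
  ∑ c : OrderedFinpartition n, scalingCoeff s c.length * ∏ m : Fin c.length, blockE μ f c m

/-- Computing a block functional: if block `m` has size `p` and its enumeration reads `f` as `g`, then
`blockE μ f c m = E_p(g)` (plumbing for the dependent types). [this work] -/
theorem blockE_eq (μ : α → ℝ) (f : Fin n → α → ℝ) (c : OrderedFinpartition n) (m : Fin c.length) {p : ℕ}
    (hp : c.partSize m = p) (g : Fin p → α → ℝ) (hg : ∀ r : Fin p, f (c.emb m (Fin.cast hp.symm r)) = g r) :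
    blockE μ f c m = sahiE μ p g := by
  subst hp
  unfold blockE
  congr 1
  funext r
  rw [← hg r]
  rfl

/-- The Lieb–Sahi recursion for a `Fin.cons` family of any positive length (plumbing: `p = q + 1`).
[cite: LiebSahi2021, Prop. 3.3] -/
theorem sahiE_cons_of_pos (μ : α → ℝ) {p : ℕ} (hp : 0 < p) (a : α → ℝ) (g : Fin p → α → ℝ) :
    sahiE μ (p + 1) (Fin.cons a g : Fin (p + 1) → α → ℝ) =
      (∑ j : Fin p, sahiE μ p (update g j (g j * a))) - sahiE μ p g * ex μ a := by
  obtain ⟨q, rfl⟩ := Nat.exists_eq_add_one.2 hp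
  rw [sahiE_succ_succ, Fin.tail_cons, Fin.cons_zero]

/-- Expectation under the scaled weight: `E_{s·μ}(g) = s·E_μ(g)`. [folklore] -/
theorem ex_smul_weight (μ : α → ℝ) (s : ℝ) (g : α → ℝ) : ex (s • μ) g = s * ex μ g := by
  simp only [ex, Pi.smul_apply, smul_eq_mul, mul_assoc, ← Finset.mul_sum]

/-! ### §3 The recursion for the scaling sum -/

/-- NEW POINT AS A SINGLETON BLOCK: the block functionals of `c.extendLeft` are `E(f_0)` and those of `c` for the tail.
[this work] -/
theorem prod_blockE_extendLeft (μ : α → ℝ) (F : Fin (n + 1) → α → ℝ) (c : OrderedFinpartition n) :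
    ∏ m : Fin c.extendLeft.length, blockE μ F c.extendLeft m =
      ex μ (F 0) * ∏ m : Fin c.length, blockE μ (Fin.tail F) c m := by
  have h0 : blockE μ F c.extendLeft (0 : Fin (c.length + 1)) = ex μ (F 0) := by
    have hp : c.extendLeft.partSize (0 : Fin (c.length + 1)) = 1 := by simp [OrderedFinpartition.extendLeft]
    rw [blockE_eq μ F c.extendLeft (0 : Fin (c.length + 1)) hp (fun _ => F 0) fun r => by
      simp [OrderedFinpartition.extendLeft]]
    exact sahiE_one_apply μ _
  have hs : ∀ m : Fin c.length, blockE μ F c.extendLeft (Fin.succ m) = blockE μ (Fin.tail F) c m := by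
    intro m
    have hp : c.extendLeft.partSize (Fin.succ m) = c.partSize m := by simp [OrderedFinpartition.extendLeft]
    exact blockE_eq μ F c.extendLeft (Fin.succ m) hp (fun r => Fin.tail F (c.emb m r)) fun _ => rfl
  show ∏ m : Fin (c.length + 1), blockE μ F c.extendLeft m = _
  rw [Fin.prod_univ_succ, h0]
  exact congrArg _ (prod_congr rfl fun m _ => hs m)

/-- The summand of the scaling sum for one set partition (bookkeeping). [this work] -/
def scalingTerm (μ : α → ℝ) (s : ℝ) (f : Fin n → α → ℝ) (c : OrderedFinpartition n) : ℝ :=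
  scalingCoeff s c.length * ∏ m : Fin c.length, blockE μ f c m

/-- The scaling sum is the sum of its summands (bookkeeping). [this work] -/
theorem scalingSum_eq_sum_scalingTerm (μ : α → ℝ) (s : ℝ) (n : ℕ) (f : Fin n → α → ℝ) :
    scalingSum μ s n f = ∑ c : OrderedFinpartition n, scalingTerm μ s f c := rfl

/-- The summand of the singleton extension: `φ_{|c|+1}(s)·E(f_0)·Π_B E(tail f|_B)`. [this work] -/
theorem scalingTerm_extendLeft (μ : α → ℝ) (s : ℝ) (F : Fin (n + 1) → α → ℝ) (c : OrderedFinpartition n) :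
    scalingTerm μ s F c.extendLeft =
      ((c.length : ℝ) - s) * scalingCoeff s c.length * (ex μ (F 0) * ∏ m : Fin c.length, blockE μ (Fin.tail F) c m) := by
  unfold scalingTerm
  rw [prod_blockE_extendLeft]
  rfl

/-- NEW POINT INSERTED INTO BLOCK `k`: that block's functional becomes `E_{|B|+1}(f_0; tail f|_B)`. [this work] -/
theorem blockE_extendMiddle_self (μ : α → ℝ) (F : Fin (n + 1) → α → ℝ) (c : OrderedFinpartition n) (k : Fin c.length) :
    blockE μ F (c.extendMiddle k) k =
      sahiE μ (c.partSize k + 1) (Fin.cons (F 0) (fun r => Fin.tail F (c.emb k r)) : Fin (c.partSize k + 1) → α → ℝ) := by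
  refine blockE_eq μ F (c.extendMiddle k) k (p := c.partSize k + 1) (by simp [OrderedFinpartition.extendMiddle]) _ ?_
  intro r
  refine Fin.cases ?_ (fun r' => ?_) r
  · simp [OrderedFinpartition.extendMiddle]
  · simp [OrderedFinpartition.extendMiddle, Fin.tail]

/-- … while the other blocks keep their functionals (for the tail). [this work] -/
theorem blockE_extendMiddle_ne (μ : α → ℝ) (F : Fin (n + 1) → α → ℝ) (c : OrderedFinpartition n) (k : Fin c.length)
    {m : Fin c.length} (hm : m ≠ k) :
    blockE μ F (c.extendMiddle k) m = blockE μ (Fin.tail F) c m := by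
  rw [blockE_eq μ F (c.extendMiddle k) m (p := c.partSize m) (by simp [OrderedFinpartition.extendMiddle, hm])
    (fun r => Fin.tail F (c.emb m r)) ?_]
  · rfl
  · intro r
    simp [OrderedFinpartition.extendMiddle, hm, Fin.tail]

/-- MODIFYING SLOT `i = c.emb k j` ONLY CHANGES THE BLOCK CONTAINING IT: the functional of block `k`. [this work] -/
theorem blockE_update_self (μ : α → ℝ) (G : Fin n → α → ℝ) (a : α → ℝ) (c : OrderedFinpartition n) (k : Fin c.length)
    (j : Fin (c.partSize k)) :
    blockE μ (update G (c.emb k j) (G (c.emb k j) * a)) c k =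
      sahiE μ (c.partSize k)
        (update (fun r => G (c.emb k r)) j ((fun r : Fin (c.partSize k) => G (c.emb k r)) j * a)) := by
  unfold blockE
  congr 1
  funext r
  by_cases h : r = j
  · subst h
    simp only [update_self]
  · rw [update_of_ne h, update_of_ne ((c.emb_strictMono k).injective.ne h)]

/-- … and not the other blocks. [this work] -/
theorem blockE_update_ne (μ : α → ℝ) (G : Fin n → α → ℝ) (a : α → ℝ) (c : OrderedFinpartition n) (k : Fin c.length)
    (j : Fin (c.partSize k)) {m : Fin c.length} (hm : m ≠ k) :
    blockE μ (update G (c.emb k j) (G (c.emb k j) * a)) c m = blockE μ G c m := by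
  unfold blockE
  congr 1
  funext r
  rw [update_of_ne (c.emb_ne_emb_of_ne hm)]

/-- The product of the block functionals of the modified family splits off block `k`. [this work] -/
theorem prod_blockE_update (μ : α → ℝ) (G : Fin n → α → ℝ) (a : α → ℝ) (c : OrderedFinpartition n) (k : Fin c.length)
    (j : Fin (c.partSize k)) :
    ∏ m : Fin c.length, blockE μ (update G (c.emb k j) (G (c.emb k j) * a)) c m =
      sahiE μ (c.partSize k)
          (update (fun r => G (c.emb k r)) j ((fun r : Fin (c.partSize k) => G (c.emb k r)) j * a)) *
        ∏ m ∈ univ.erase k, blockE μ G c m := by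
  rw [← mul_prod_erase univ _ (mem_univ k), blockE_update_self]
  congr 1
  exact prod_congr rfl fun m hm => blockE_update_ne μ G a c k j (ne_of_mem_erase hm)

/-- SUM OVER "INSERT `0` INTO A BLOCK", the block of `0` expanded by the Lieb–Sahi recursion:
`Σ_k φ_{|c|} Π_B E(F|_{B'}) = φ_{|c|}·(Σ_i Π_B E((tail F)^{(i)}|_B) − |c|·E(F_0)·Π_B E(tail F|_B))`. [this work] -/
theorem sum_scalingTerm_extendMiddle (μ : α → ℝ) (s : ℝ) (F : Fin (n + 1) → α → ℝ) (c : OrderedFinpartition n) :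
    ∑ k : Fin c.length, scalingTerm μ s F (c.extendMiddle k) =
      scalingCoeff s c.length *
        ((∑ i : Fin n, ∏ m : Fin c.length, blockE μ (update (Fin.tail F) i (Fin.tail F i * F 0)) c m) -
          (c.length : ℝ) * (ex μ (F 0) * ∏ m : Fin c.length, blockE μ (Fin.tail F) c m)) := by
  -- each `k`: split off block `k` and expand it by the recursion
  have hk : ∀ k : Fin c.length,
      scalingTerm μ s F (c.extendMiddle k) =
        scalingCoeff s c.length *
          (((∑ j : Fin (c.partSize k), sahiE μ (c.partSize k)
                (update (fun r => Fin.tail F (c.emb k r)) j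
                  ((fun r : Fin (c.partSize k) => Fin.tail F (c.emb k r)) j * F 0))) -
              sahiE μ (c.partSize k) (fun r => Fin.tail F (c.emb k r)) * ex μ (F 0)) *
            ∏ m ∈ univ.erase k, blockE μ (Fin.tail F) c m) := by
    intro k
    show scalingCoeff s c.length * ∏ m : Fin c.length, blockE μ F (c.extendMiddle k) m = _
    congr 1
    rw [← mul_prod_erase univ _ (mem_univ k), blockE_extendMiddle_self, sahiE_cons_of_pos μ (c.partSize_pos k)]
    congr 1
    exact prod_congr rfl fun m hm => blockE_extendMiddle_ne μ F c k (ne_of_mem_erase hm)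
  simp_rw [hk]
  rw [← mul_sum]
  congr 1
  simp_rw [sub_mul, sum_mul]
  rw [sum_sub_distrib]
  congr 1
  · -- `Σ_k Σ_{j ∈ block k} = Σ_i`, and the summand is the full block product of the modified family
    rw [← c.sum_sigma_eq_sum fun i => ∏ m : Fin c.length, blockE μ (update (Fin.tail F) i (Fin.tail F i * F 0)) c m]
    refine sum_congr rfl fun k _ => sum_congr rfl fun j _ => ?_
    rw [prod_blockE_update]
  · -- `k` identical subtracted terms
    have hterm : ∀ k : Fin c.length,
        sahiE μ (c.partSize k) (fun r => Fin.tail F (c.emb k r)) * ex μ (F 0) * ∏ m ∈ univ.erase k, blockE μ (Fin.tail F) c m =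
          ex μ (F 0) * ∏ m : Fin c.length, blockE μ (Fin.tail F) c m := by
      intro k
      rw [← mul_prod_erase univ (fun m => blockE μ (Fin.tail F) c m) (mem_univ k)]
      unfold blockE
      ring
    simp_rw [hterm]
    rw [sum_const, card_univ, Fintype.card_fin, nsmul_eq_mul]

/-- **The scaling sum satisfies the Lieb–Sahi recursion with head weight `s·E(f_0)`.** [this work] -/
theorem scalingSum_succ (μ : α → ℝ) (s : ℝ) (n : ℕ) (F : Fin (n + 2) → α → ℝ) :
    scalingSum μ s (n + 2) F =
      (∑ i : Fin (n + 1), scalingSum μ s (n + 1) (update (Fin.tail F) i (Fin.tail F i * F 0))) -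
        s * ex μ (F 0) * scalingSum μ s (n + 1) (Fin.tail F) := by
  simp only [scalingSum_eq_sum_scalingTerm]
  rw [← Fintype.sum_equiv (OrderedFinpartition.extendEquiv (n + 1)) (fun p => scalingTerm μ s F (p.1.extend p.2))
      (fun c' => scalingTerm μ s F c') (fun p => rfl), Fintype.sum_sigma]
  simp_rw [Fintype.sum_option, OrderedFinpartition.extend_none, OrderedFinpartition.extend_some, scalingTerm_extendLeft,
    sum_scalingTerm_extendMiddle]
  have hc : ∀ c : OrderedFinpartition (n + 1),
      ((c.length : ℝ) - s) * scalingCoeff s c.length * (ex μ (F 0) * ∏ m : Fin c.length, blockE μ (Fin.tail F) c m) +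
          scalingCoeff s c.length *
            ((∑ i : Fin (n + 1), ∏ m : Fin c.length, blockE μ (update (Fin.tail F) i (Fin.tail F i * F 0)) c m) -
              (c.length : ℝ) * (ex μ (F 0) * ∏ m : Fin c.length, blockE μ (Fin.tail F) c m)) =
        (∑ i : Fin (n + 1), scalingTerm μ s (update (Fin.tail F) i (Fin.tail F i * F 0)) c) -
          s * ex μ (F 0) * scalingTerm μ s (Fin.tail F) c := by
    intro c
    unfold scalingTerm
    rw [← mul_sum]
    ring
  simp_rw [hc]
  rw [sum_sub_distrib, sum_comm, ← mul_sum]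

/-- The scaling sum of one function: `φ_1(s)·E(f) = s·E(f)`. [this work] -/
theorem scalingSum_one (μ : α → ℝ) (s : ℝ) (F : Fin 1 → α → ℝ) : scalingSum μ s 1 F = s * ex μ (F 0) := by
  unfold scalingSum
  rw [Fintype.sum_unique, OrderedFinpartition.default_eq]
  have hblock : blockE μ F (OrderedFinpartition.atomic 1) (0 : Fin 1) = ex μ (F 0) := by
    rw [blockE_eq μ F (OrderedFinpartition.atomic 1) (0 : Fin 1) (p := 1) rfl (fun _ => F 0) fun r => by
      have hr : r = 0 := Subsingleton.elim r 0
      subst hr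
      simp [OrderedFinpartition.atomic]]
    exact sahiE_one_apply μ _
  have hprod : ∏ m : Fin (OrderedFinpartition.atomic 1).length, blockE μ F (OrderedFinpartition.atomic 1) m = ex μ (F 0) := by
    show ∏ m : Fin 1, blockE μ F (OrderedFinpartition.atomic 1) m = _
    rw [Fin.prod_univ_one, hblock]
  rw [hprod]
  show scalingCoeff s 1 * ex μ (F 0) = _
  rw [scalingCoeff_one]

/-! ### §4 The theorem and its consequences -/

/-- **SAHI'S `E_n` UNDER SCALING OF THE WEIGHT (all orders).**  For every finite type, every real weight `μ`, every real `s`,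
every `n` and every family `f` of `n + 1` real functions:
`E_{n+1}^{s·μ}(f) = Σ_{π} φ_{|π|}(s) · Π_{B∈π} E_{|B|}^{μ}(f|_B)` (sum over the set partitions of `{0,…,n}`; `φ_k(s) = s(1−s)⋯(k−1−s)`).
[this work; mechanism: Sahi2008, eq. (14), Prop. 12 and the proof of Thm. 1 (p. 218–219)] -/
theorem sahiE_smul_weight (μ : α → ℝ) (s : ℝ) :
    ∀ (n : ℕ) (f : Fin (n + 1) → α → ℝ), sahiE (s • μ) (n + 1) f = scalingSum μ s (n + 1) f
  | 0, f => by rw [scalingSum_one, sahiE_one_apply, ex_smul_weight]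
  | n + 1, f => by
    rw [scalingSum_succ, sahiE_succ_succ, ex_smul_weight, sahiE_smul_weight μ s n (Fin.tail f)]
    congr 1
    · exact sum_congr rfl fun i _ => sahiE_smul_weight μ s n _
    · ring

/-- The same, fully unfolded: `E_{n+1}^{s·μ}(f) = Σ_c φ_{|c|}(s) · Π_m E_{|c_m|}^{μ}(f ∘ c.emb m)` over Mathlib's ordered finpartitions
`c` of `Fin (n+1)` (= the set partitions, once each). [this work] -/
theorem sahiE_smul_weight_eq_sum (μ : α → ℝ) (s : ℝ) (n : ℕ) (f : Fin (n + 1) → α → ℝ) :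
    sahiE (s • μ) (n + 1) f =
      ∑ c : OrderedFinpartition (n + 1), scalingCoeff s c.length *
        ∏ m : Fin c.length, sahiE μ (c.partSize m) (fun r => f (c.emb m r)) :=
  sahiE_smul_weight μ s n f

/-- **At `s = 1`**: Sahi's `E_{n+1}^{μ}(f)` itself is the scaling sum with coefficients `φ_k(1)` (`= 1` on the one-block partition,
`0` on all others) — recorded as the bridge used below. [this work] -/
theorem sahiE_eq_scalingSum_one (μ : α → ℝ) (n : ℕ) (f : Fin (n + 1) → α → ℝ) :
    sahiE μ (n + 1) f = scalingSum μ 1 (n + 1) f := by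
  rw [← sahiE_smul_weight μ 1 n f, one_smul]

/-- **The excess over the chord**: `E_{n+1}^{s·μ}(f) − s·E_{n+1}^{μ}(f) = Σ_{|π| ≥ 2} φ_{|π|}(s) Π_{B∈π} E_{|B|}(f|_B)`.
[this work] -/
theorem sahiE_smul_weight_sub (μ : α → ℝ) (s : ℝ) (n : ℕ) (f : Fin (n + 1) → α → ℝ) :
    sahiE (s • μ) (n + 1) f - s * sahiE μ (n + 1) f =
      ∑ c : OrderedFinpartition (n + 1),
        (if 2 ≤ c.length then scalingCoeff s c.length else 0) * ∏ m : Fin c.length, blockE μ f c m := by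
  rw [sahiE_smul_weight, sahiE_eq_scalingSum_one]
  unfold scalingSum
  rw [mul_sum, ← sum_sub_distrib]
  have key : ∀ k : ℕ, 1 ≤ k →
      scalingCoeff s k - s * scalingCoeff 1 k = if 2 ≤ k then scalingCoeff s k else 0 := by
    intro k hk
    obtain ⟨l, rfl⟩ : ∃ l, k = l + 1 := Nat.exists_eq_add_one.2 hk
    rcases l with _ | l
    · rw [scalingCoeff_one, scalingCoeff_one_one, if_neg (by omega)]
      ring
    · rw [scalingCoeff_one_add_two, if_pos (by omega)]
      ring
  refine sum_congr rfl fun c _ => ?_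
  rw [← key c.length (c.length_pos (Nat.succ_pos n))]
  ring

/-- In a set partition with at least two blocks every block is a PROPER sub-family: `|c_m| ≤ n` (of `n + 1` points).
[folklore] -/
theorem partSize_le_of_two_le_length (c : OrderedFinpartition (n + 1)) (hc : 2 ≤ c.length) (m : Fin c.length) :
    c.partSize m ≤ n := by
  have hsum : ∑ m : Fin c.length, c.partSize m = n + 1 := by
    have h := c.sum_sigma_eq_sum fun _ => (1 : ℕ)
    simpa using h
  haveI : Nontrivial (Fin c.length) := Fin.nontrivial_iff_two_le.mpr hc
  obtain ⟨m', hm'⟩ := exists_ne m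
  have h1 : c.partSize m + c.partSize m' ≤ ∑ m : Fin c.length, c.partSize m := by
    rw [← add_sum_erase univ _ (mem_univ m)]
    exact Nat.add_le_add_left (single_le_sum (f := fun m => c.partSize m) (fun _ _ => Nat.zero_le _)
      (mem_erase.2 ⟨hm', mem_univ m'⟩)) _
  have h2 := c.partSize_pos m'
  omega

/-- **CONJECTURE V_∅ AT EVERY ORDER, conditionally on Sahi positivity of the proper sub-families.**  For any real weight `μ`,
`0 ≤ s ≤ 1` and a family `f` of `n + 1` functions all of whose sub-families of size `≤ n` (read increasingly) have `E_m ≥ 0`: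
`s · E_{n+1}^{μ}(f) ≤ E_{n+1}^{s·μ}(f)`. [this work] -/
theorem mul_sahiE_le_sahiE_smul (μ : α → ℝ) {s : ℝ} (hs0 : 0 ≤ s) (hs1 : s ≤ 1) (f : Fin (n + 1) → α → ℝ)
    (hpos : ∀ m, m ≤ n → ∀ e : Fin m → Fin (n + 1), StrictMono e → 0 ≤ sahiE μ m (fun j => f (e j))) :
    s * sahiE μ (n + 1) f ≤ sahiE (s • μ) (n + 1) f := by
  rw [← sub_nonneg, sahiE_smul_weight_sub]
  refine sum_nonneg fun c _ => ?_
  split_ifs with hc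
  · obtain ⟨l, hl⟩ : ∃ l, c.length = l + 1 := Nat.exists_eq_add_one.2 (c.length_pos (Nat.succ_pos n))
    refine mul_nonneg (by rw [hl]; exact scalingCoeff_succ_nonneg hs0 hs1 l) (prod_nonneg fun m _ => ?_)
    exact hpos _ (partSize_le_of_two_le_length c hc m) _ (c.emb_strictMono m)
  · rw [zero_mul]

end

end Summit.CriticalPhenomena.PercolationContinuityZ3.Theorems.SahiTangent
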